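import Summits.CriticalPhenomena.PercolationContinuityZ3.Theorems.PercExchangeRateTransportTransportLemmaFence

/-!
# Transport lemma of route `PercExchangeRateTransport` — level transport along the exact characteristic (`stub_levelTransport`)

Crux `Summit.CriticalPhenomena.PercolationContinuityZ3.Theses.PercExchangeRateTransport.TransportLemma`
(stmt-CriticalPhenomena-16063), line `corrector` (tree `Cruxes/TransportLemma/Lines/corrector.lean` rev 2,
strategist planner-cstrat-stmt-CriticalPhenomena-16063-b1-0; landed by the line lead).

Statement (`stub_levelTransport`, the level-transport statement of line `birth`, verbatim): given that the
threshold curve `pc` is a characteristic of the field (`HasDerivWithinAt pc (−a(pc t,t))` on `[lo,hi]`) and the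
right-collar data (continuity and `L`-Lipschitz-in-`p` of `a`, the exchange inequality on the closed right collar),
for `lo ≤ t₀ ≤ t₁ ≤ hi` and every small `ε > 0`:
`⨅ₙ Θ n (pc t₁) t₁ ≤ ⨅ₙ Θ n (pc t₀ + ε) t₀` and `⨅ₙ Θ n (pc t₀) t₀ ≤ ⨅ₙ Θ n (pc t₁ + ε) t₁`.
Engine: EXACT CHARACTERISTIC + CLOSED-FORM EXPONENTIAL CORRECTOR — `γ = pc + g` with
`g(s) = (ε + η/L')e^{−L'(s−t₀)} − η/L'` (decreasing corrector) resp. `g(s) = (η/L')(e^{L'(s−t₀)} − 1)`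
(increasing corrector), `η = L' ε e^{−L'(t₁−t₀)}/2`, `L' = max L 1`; by the Lipschitz clause alone these are
super- resp. sub-characteristics (`γ' + a(γ,·) ≤ −η`, resp. `≥ η`) and the fence lemma makes every `Θ n`, `n ≥ m(η)`,
monotone along them. No Euler polygons, no discrete Grönwall, no ODE existence theory.
-/

namespace Summit.CriticalPhenomena.PercolationContinuityZ3.Theorems.TransportLemma

open Filter Topology Set

/-- **Level transport (proved).** Given the characteristic property of `pc` and the right-collar
hypotheses, for `lo ≤ t₀ ≤ t₁ ≤ hi` and every `ε ∈ (0, ρ)`: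
`Θ∞ (pc t₁) t₁ ≤ Θ∞ (pc t₀ + ε) t₀` and `Θ∞ (pc t₀) t₀ ≤ Θ∞ (pc t₁ + ε) t₁`.
Engine: `γ = pc + g` with `g(s) = (ε + η/L')e^{−L'(s−t₀)} − η/L'` (decreasing corrector) resp.
`g(s) = (η/L')(e^{L'(s−t₀)} − 1)` (increasing corrector), `η = L' ε e^{−L'(t₁−t₀)}/2`,
`L' = max L 1`; the fence lemma does the rest. -/
theorem stub_levelTransport :
    ∀ (Θ : ℕ → ℝ → ℝ → ℝ) (pc : ℝ → ℝ) (a : ℝ → ℝ → ℝ) (lo hi ρ L : ℝ),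
      0 < lo → lo < hi → hi < 1 → 0 < ρ →
      (∀ n, ContDiffOn ℝ 1 (fun x : ℝ × ℝ => Θ n x.1 x.2) (Set.Ioo 0 1 ×ˢ Set.Ioo 0 1)) →
      (∀ n t, Monotone (fun p => Θ n p t)) →
      (∀ p t, Antitone (fun n => Θ n p t)) →
      (∀ n p t, 0 ≤ Θ n p t) →
      ContinuousOn pc (Set.Icc lo hi) →
      (∀ t ∈ Set.Icc lo hi, ρ < pc t ∧ pc t + ρ < 1) →
      ContinuousOn (fun x : ℝ × ℝ => a x.1 x.2)
          {x : ℝ × ℝ | x.2 ∈ Set.Icc lo hi ∧ pc x.2 ≤ x.1 ∧ x.1 ≤ pc x.2 + ρ} →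
      (∀ t ∈ Set.Icc lo hi, ∀ p q : ℝ, pc t ≤ p → p ≤ pc t + ρ → pc t ≤ q → q ≤ pc t + ρ →
          |a p t - a q t| ≤ L * |p - q|) →
      (∀ η > (0 : ℝ), ∃ m : ℕ, ∀ n ≥ m, ∀ t ∈ Set.Icc lo hi, ∀ p : ℝ,
          pc t ≤ p → p ≤ pc t + ρ →
          |deriv (fun s => Θ n p s) t - a p t * deriv (fun q => Θ n q t) p|
            ≤ η * deriv (fun q => Θ n q t) p) →
      (∀ t ∈ Set.Icc lo hi, HasDerivWithinAt pc (-(a (pc t) t)) (Set.Icc lo hi) t) →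
      ∀ t₀ t₁ : ℝ, lo ≤ t₀ → t₀ ≤ t₁ → t₁ ≤ hi →
        ∃ ε₀ > (0 : ℝ), ∀ ε : ℝ, 0 < ε → ε < ε₀ →
          (⨅ n, Θ n (pc t₁) t₁) ≤ (⨅ n, Θ n (pc t₀ + ε) t₀) ∧
          (⨅ n, Θ n (pc t₀) t₀) ≤ (⨅ n, Θ n (pc t₁ + ε) t₁) := by
  intro Θ pc a lo hi ρ L hlo hlohi hhi hρ hC1 hmp hanti hnn hpc hcollar ha hL hex hchar
    t₀ t₁ ht₀ ht₀₁ ht₁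
  refine ⟨ρ, hρ, fun ε hε hερ => ?_⟩
  -- constants
  obtain ⟨L', hLL', hL'pos⟩ : ∃ L' : ℝ, L ≤ L' ∧ 0 < L' :=
    ⟨max L 1, le_max_left _ _, lt_of_lt_of_le one_pos (le_max_right _ _)⟩
  set T : ℝ := t₁ - t₀ with hT
  have hT0 : 0 ≤ T := by rw [hT]; linarith
  set E₀ : ℝ := Real.exp (-(L' * T)) with hE₀
  have hE₀pos : 0 < E₀ := Real.exp_pos _
  have hE₀le : E₀ ≤ 1 := by
    rw [hE₀]; apply Real.exp_le_one_iff.mpr; nlinarith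
  set η : ℝ := L' * ε * E₀ / 2 with hη
  have hηpos : 0 < η := by positivity
  have hηL' : η / L' = ε * E₀ / 2 := by
    rw [hη]; field_simp
  obtain ⟨m, hm⟩ := hex η hηpos
  -- bookkeeping
  have hIcc : Set.Icc t₀ t₁ ⊆ Set.Icc lo hi := Set.Icc_subset_Icc ht₀ ht₁
  have bdd : ∀ q s, BddBelow (Set.range fun n => Θ n q s) := fun q s =>
    ⟨0, by rintro _ ⟨n, rfl⟩; exact hnn n q s⟩
  have infle : ∀ q s q' s', (∀ n ≥ m, Θ n q s ≤ Θ n q' s') →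
      (⨅ n, Θ n q s) ≤ ⨅ n, Θ n q' s' := by
    intro q s q' s' h
    refine le_ciInf fun N => ?_
    calc (⨅ n, Θ n q s) ≤ Θ (max N m) q s := ciInf_le (bdd q s) _
      _ ≤ Θ (max N m) q' s' := h _ (le_max_right _ _)
      _ ≤ Θ N q' s' := hanti q' s' (le_max_left _ _)
  have hsq : IsOpen (Set.Ioo (0:ℝ) 1 ×ˢ Set.Ioo (0:ℝ) 1) := isOpen_Ioo.prod isOpen_Ioo
  have hdiff : ∀ n, ∀ s ∈ Set.Icc t₀ t₁, ∀ q, pc s ≤ q → q < pc s + ρ →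
      DifferentiableAt ℝ (fun x : ℝ × ℝ => Θ n x.1 x.2) (q, s) := by
    intro n s hs q hq1 hq2
    have hs' := hIcc hs
    obtain ⟨hc1, hc2⟩ := hcollar s hs'
    apply ((hC1 n).differentiableOn one_ne_zero).differentiableAt
    apply hsq.mem_nhds
    refine ⟨⟨by linarith, by linarith⟩, ⟨by linarith [hs'.1], by linarith [hs'.2]⟩⟩
  -- exponential bounds on [t₀,t₁]
  have hexp_le_one : ∀ s ∈ Set.Icc t₀ t₁, Real.exp (-(L' * (s - t₀))) ≤ 1 := by
    intro s hs
    apply Real.exp_le_one_iff.mpr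
    nlinarith [hs.1]
  have hexp_ge : ∀ s ∈ Set.Icc t₀ t₁, E₀ ≤ Real.exp (-(L' * (s - t₀))) := by
    intro s hs
    rw [hE₀]; apply Real.exp_le_exp.mpr
    nlinarith [hs.2]
  have hexp_ge' : ∀ s ∈ Set.Icc t₀ t₁, 1 ≤ Real.exp (L' * (s - t₀)) := by
    intro s hs
    apply Real.one_le_exp_iff.mpr
    nlinarith [hs.1]
  have hexp_le' : ∀ s ∈ Set.Icc t₀ t₁, Real.exp (L' * (s - t₀)) ≤ 1 / E₀ := by
    intro s hs
    rw [hE₀, one_div, ← Real.exp_neg, neg_neg]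
    apply Real.exp_le_exp.mpr
    nlinarith [hs.2]
  constructor
  · ----------------------------------------------------------------
    -- (i) decreasing corrector g s = (ε + η/L') e^{-L'(s-t₀)} - η/L'
    ----------------------------------------------------------------
    set g : ℝ → ℝ := fun s => (ε + η / L') * Real.exp (-(L' * (s - t₀))) - η / L' with hg
    set g' : ℝ → ℝ := fun s => -(L' * g s) - η with hg'
    have hgd : ∀ s, HasDerivAt g (g' s) s := by
      intro s
      have h1 : HasDerivAt (fun r => -(L' * (r - t₀))) (-(L' * 1)) s :=
        (((hasDerivAt_id s).sub_const t₀).const_mul L').neg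
      have h2 := ((h1.exp).const_mul (ε + η / L')).sub_const (η / L')
      refine h2.congr_deriv ?_
      have hLη : L' * (η / L') = η := by field_simp
      simp only [hg', hg]
      generalize Real.exp (-(L' * (s - t₀))) = E
      rw [mul_sub, hLη]
      ring
    have hg0 : g t₀ = ε := by
      simp only [hg, sub_self, mul_zero, neg_zero, Real.exp_zero, mul_one]; ring
    have hg_le : ∀ s ∈ Set.Icc t₀ t₁, g s ≤ ε := by
      intro s hs
      have h1 := hexp_le_one s hs
      have hpos : 0 ≤ ε + η / L' := by positivity
      have : (ε + η / L') * Real.exp (-(L' * (s - t₀))) ≤ (ε + η / L') * 1 :=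
        mul_le_mul_of_nonneg_left h1 hpos
      simp only [hg]; linarith
    have hg_pos : ∀ s ∈ Set.Icc t₀ t₁, 0 < g s := by
      intro s hs
      have h1 := hexp_ge s hs
      have hpos : 0 ≤ ε + η / L' := by positivity
      have h2 : (ε + η / L') * E₀ ≤ (ε + η / L') * Real.exp (-(L' * (s - t₀))) :=
        mul_le_mul_of_nonneg_left h1 hpos
      have h3 : 0 < (ε + η / L') * E₀ - η / L' := by
        rw [hηL']; nlinarith [mul_pos hε hE₀pos, sq_nonneg E₀]
      simp only [hg]; linarith
    -- the curve γ = pc + g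
    set γ : ℝ → ℝ := fun s => pc s + g s with hγ
    have hγ_ge : ∀ s ∈ Set.Icc t₀ t₁, pc s ≤ γ s := fun s hs => by
      simp only [hγ]; linarith [hg_pos s hs]
    have hγ_lt : ∀ s ∈ Set.Icc t₀ t₁, γ s < pc s + ρ := fun s hs => by
      simp only [hγ]; linarith [hg_le s hs]
    have hγd : ∀ s ∈ Set.Icc t₀ t₁,
        HasDerivWithinAt γ (-(a (pc s) s) + g' s) (Set.Icc t₀ t₁) s := fun s hs =>
      ((hchar s (hIcc hs)).mono hIcc).add (hgd s).hasDerivWithinAt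
    have hslope : ∀ s ∈ Set.Icc t₀ t₁, (-(a (pc s) s) + g' s) + a (γ s) s ≤ -η := by
      intro s hs
      have hs' := hIcc hs
      have h1 := hL s hs' (γ s) (pc s) (hγ_ge s hs) (hγ_lt s hs).le le_rfl (by linarith)
      have e1 : |γ s - pc s| = g s := by
        rw [abs_of_nonneg (by simp only [hγ]; linarith [hg_pos s hs])]; simp only [hγ]; ring
      rw [e1] at h1
      have h2 : a (γ s) s - a (pc s) s ≤ L' * g s := by
        have := (abs_le.1 h1).2
        nlinarith [hg_pos s hs]
      simp only [hg'] at *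
      linarith
    have key : ∀ n ≥ m, Θ n (pc t₁) t₁ ≤ Θ n (pc t₀ + ε) t₀ := by
      intro n hn
      have hA : AntitoneOn (fun s => Θ n (γ s) s) (Set.Icc t₀ t₁) :=
        fence_antitoneOn (Θ n) a γ (fun s => -(a (pc s) s) + g' s) η t₀ t₁
          (fun s hs => hdiff n s hs (γ s) (hγ_ge s hs) (hγ_lt s hs))
          (hmp n) hγd
          (fun s hs => hm n hn s (hIcc hs) (γ s) (hγ_ge s hs) (hγ_lt s hs).le)
          hslope
      have h1 : Θ n (γ t₁) t₁ ≤ Θ n (γ t₀) t₀ :=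
        hA (Set.left_mem_Icc.2 ht₀₁) (Set.right_mem_Icc.2 ht₀₁) ht₀₁
      have h2 : γ t₀ = pc t₀ + ε := by simp only [hγ, hg0]
      have h3 : Θ n (pc t₁) t₁ ≤ Θ n (γ t₁) t₁ := hmp n t₁ (hγ_ge t₁ (Set.right_mem_Icc.2 ht₀₁))
      rw [h2] at h1
      exact h3.trans h1
    exact infle _ _ _ _ key
  · ----------------------------------------------------------------
    -- (ii) increasing corrector g s = (η/L') (e^{L'(s-t₀)} - 1)
    ----------------------------------------------------------------
    set g : ℝ → ℝ := fun s => (η / L') * (Real.exp (L' * (s - t₀)) - 1) with hg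
    set g' : ℝ → ℝ := fun s => L' * g s + η with hg'
    have hgd : ∀ s, HasDerivAt g (g' s) s := by
      intro s
      have h1 : HasDerivAt (fun r => L' * (r - t₀)) (L' * 1) s :=
        ((hasDerivAt_id s).sub_const t₀).const_mul L'
      have h2 := ((h1.exp).sub_const 1).const_mul (η / L')
      refine h2.congr_deriv ?_
      have hLη : η / L' * L' = η := by field_simp
      simp only [hg', hg]
      generalize Real.exp (L' * (s - t₀)) = E
      calc η / L' * (E * (L' * 1)) = (η / L' * L') * E := by ring
        _ = η * E := by rw [hLη]
        _ = (η / L' * L') * (E - 1) + η := by rw [hLη]; ring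
        _ = L' * (η / L' * (E - 1)) + η := by ring
    have hg0 : g t₀ = 0 := by
      simp only [hg, sub_self, mul_zero, Real.exp_zero, sub_self, mul_zero]
    have hg_nn : ∀ s ∈ Set.Icc t₀ t₁, 0 ≤ g s := by
      intro s hs
      have h1 := hexp_ge' s hs
      have : 0 ≤ η / L' := by positivity
      simp only [hg]
      exact mul_nonneg this (by linarith)
    have hg_lt : ∀ s ∈ Set.Icc t₀ t₁, g s < ε := by
      intro s hs
      have h1 := hexp_le' s hs
      have h0 : 0 ≤ η / L' := by positivity
      have h2 : g s ≤ (η / L') * (1 / E₀ - 1) := by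
        simp only [hg]; exact mul_le_mul_of_nonneg_left (by linarith) h0
      have h3 : (η / L') * (1 / E₀ - 1) < ε := by
        rw [hηL']
        field_simp
        nlinarith [mul_pos hε hE₀pos, mul_pos (mul_pos hε hE₀pos) hE₀pos]
      linarith
    set γ : ℝ → ℝ := fun s => pc s + g s with hγ
    have hγ_ge : ∀ s ∈ Set.Icc t₀ t₁, pc s ≤ γ s := fun s hs => by
      simp only [hγ]; linarith [hg_nn s hs]
    have hγ_lt : ∀ s ∈ Set.Icc t₀ t₁, γ s < pc s + ρ := fun s hs => by
      simp only [hγ]; linarith [hg_lt s hs]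
    have hγd : ∀ s ∈ Set.Icc t₀ t₁,
        HasDerivWithinAt γ (-(a (pc s) s) + g' s) (Set.Icc t₀ t₁) s := fun s hs =>
      ((hchar s (hIcc hs)).mono hIcc).add (hgd s).hasDerivWithinAt
    have hslope : ∀ s ∈ Set.Icc t₀ t₁, η ≤ (-(a (pc s) s) + g' s) + a (γ s) s := by
      intro s hs
      have hs' := hIcc hs
      have h1 := hL s hs' (γ s) (pc s) (hγ_ge s hs) (hγ_lt s hs).le le_rfl (by linarith)
      have e1 : |γ s - pc s| = g s := by
        rw [abs_of_nonneg (by simp only [hγ]; linarith [hg_nn s hs])]; simp only [hγ]; ring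
      rw [e1] at h1
      have h2 : -(L' * g s) ≤ a (γ s) s - a (pc s) s := by
        have := (abs_le.1 h1).1
        nlinarith [hg_nn s hs]
      simp only [hg'] at *
      linarith
    have key : ∀ n ≥ m, Θ n (pc t₀) t₀ ≤ Θ n (pc t₁ + ε) t₁ := by
      intro n hn
      have hM : MonotoneOn (fun s => Θ n (γ s) s) (Set.Icc t₀ t₁) :=
        fence_monotoneOn (Θ n) a γ (fun s => -(a (pc s) s) + g' s) η t₀ t₁
          (fun s hs => hdiff n s hs (γ s) (hγ_ge s hs) (hγ_lt s hs))
          (hmp n) hγd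
          (fun s hs => hm n hn s (hIcc hs) (γ s) (hγ_ge s hs) (hγ_lt s hs).le)
          hslope
      have h1 : Θ n (γ t₀) t₀ ≤ Θ n (γ t₁) t₁ :=
        hM (Set.left_mem_Icc.2 ht₀₁) (Set.right_mem_Icc.2 ht₀₁) ht₀₁
      have h2 : γ t₀ = pc t₀ := by simp only [hγ, hg0, add_zero]
      have h3 : Θ n (γ t₁) t₁ ≤ Θ n (pc t₁ + ε) t₁ :=
        hmp n t₁ (by simp only [hγ]; linarith [hg_lt t₁ (Set.right_mem_Icc.2 ht₀₁)])
      rw [h2] at h1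
      exact h1.trans h3
    exact infle _ _ _ _ key

end Summit.CriticalPhenomena.PercolationContinuityZ3.Theorems.TransportLemma
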